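import Summits.BirchSwinnertonDyer.BirchSwinnertonDyer.Theorems.EisensteinPrimesAcTwistDeformationSUR
import Summits.BirchSwinnertonDyer.BirchSwinnertonDyer.Theorems.EisensteinPrimesGreenbergArchimedeanH1
import HarnessLib

/-!
# Crux `AnticyclotomicEisensteinDivisibility` (stmt-BirchSwinnertonDyer-20727), line `bdpline` v15, stub
# `stub_finiteExponentSS`, Greenberg-2016 road at CORANK `m`: LEO(`𝐃`) and CRK(`𝐃`, `𝓛_η`) for the
# specification "no condition at `η`, zero elsewhere" by the CORANK SQUEEZE, for a cofree `𝐃` of ANY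
# corank `m` over ANY `Λ ≅ ℤ_p⟦T₁,…,T_{m_Λ}⟧` (helper for stmt-BirchSwinnertonDyer-20727)

Cell `bsd-ssimc` (hosting route `SignedBaseChange`), width seat `bsd-line-sbc-p1-w2` gen 3, lane
`stub_finiteExponentSS` via Greenberg 2016 Prop. 4.1.1 for the twist deformation
`𝐃 = Ind_{K̃_∞/K}(E_K[p^∞])` (corank `m = 2` over `Λ₂`), continuing the end layer
`SignedBaseChangeAcDivFiniteExponent.stub_finiteExponentSS_of_bridge`. Cell `bsd-eis` obtained the two
arithmetic hypotheses LEO(`𝐃`) and CRK(`𝐃`, `𝓛`) of Prop. 4.1.1 in two ways: over the `ℤ_p²`-tower for a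
corank-ONE `𝐃₂` from the VANISHING `H²(K_Σ/K̃_∞, A) = 0` (`GreenbergFullAtSelmer.hasCorank_H1_one_of_prop41`,
`CRK_fullAt_of_coranks` — corank `1` hard-wired), and on the anticyclotomic line for a corank-ONE `𝐃₁`
by the CORANK SQUEEZE of [Greenberg2016Selmer] §2.3 (2) ∧ [Greenberg2006] Prop. 4.1
(`AcTwistDeformation.hasCorank_H1_one_and_H2_zero`, again with `m = 1` hard-wired). For `E_K[p^∞]`
(`m = 2`) no vanishing of `H²` above `K̃_∞` is in the tree, but the squeeze needs none: this file is the
squeeze at ARBITRARY corank `m`, generic over Greenberg's arena (`Λ`, `m_Λ`, `𝐃`, `ρ`), for a number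
field `K` all of whose archimedean places are complex with `r₂ = 1` (imaginary quadratic) and the
specification `𝓛_η = fullAtSpecification S ρ (inr η)` with ONE other place `η' ∈ Σ` of local degree one
above `p` carrying `corank H¹(K_{η'}, 𝐃) = m`:

* §1 `isCofinitelyGenerated_submodule` — a submodule of a cofinitely generated `Λ`-module is cofinitely
  generated (its dual is a quotient of a finitely generated module); so `S_𝓛 ≤ H¹(K_Σ/K, 𝐃)` is, once
  Greenberg 2006 Prop. 3.2 is granted.
* §2 `hasCorank_QGlobal_fullAt_of_corank` — `corank Q_{𝓛_η}(K, 𝐃) = m` when `corank H¹(K_{η'}, 𝐃) = m`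
  and `H¹(K_v, 𝐃)` is cotorsion at the other places of `Σ` (bsd-eis `hasCorank_QGlobal_fullAt_one`, `1 ↦ m`).
* §3 `hasCorank_H1_and_H2_zero_of_corank` — THE SQUEEZE at corank `m`: `corank 𝐃 = m`, `corank H⁰ = 0`,
  `corank S_𝓛 = 0`, `corank Q_𝓛 = m` and Prop. 4.1 (`h⁰ − h¹ + h² = −r₂·m = −m`) force `h¹ = m` AND
  `h² = 0`; `CRK_fullAt_of_coranks_of_corank` — CRK from the three values `m = 0 + m`.
* §4 `leo_and_crk_fullAt_of_squeeze` — ASSEMBLY from the PUBLISHED facts Greenberg 2006 Props. 3.2,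
  4.1, 4.2, §5 A (hypotheses BY NAME): for `K` with all archimedean places complex and `r₂ = 1`,
  `S ⊇ {v ∣ p}` finite whose places above `p` are `η ≠ η'` with `e(η'|p)f(η'|p) = 1`, a `p`-primary
  cofinitely generated `𝐃` of corank `m` with `corank H⁰(K_Σ/K, 𝐃) = 0`, LOC_v⁽¹⁾ and
  `corank H⁰(K_v, 𝐃) = 0` at every finite `v ∈ S`, and `corank S_{𝓛_η}(K, 𝐃) = 0`:
  **LEO(`𝐃`) ∧ CRK(`𝐃`, `𝓛_η`) ∧ `corank H¹(K_Σ/K, 𝐃) = m` ∧ `corank H²(K_Σ/K, 𝐃) = 0`.**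
  At the crux's instance `𝐃 = Ind(E_K[p^∞])`, `m = 2`, `η = v`, `η' = v̄`, the input `corank S_{𝓛_v} = 0`
  is `SignedBaseChangeAcDivFiniteExponent.hasCorank_zero_of_xGr₂_isTorsion` (the line's
  `stub_torsionSS` through the Shapiro bridge).
* §5 (appended) `hasCorank_H0_zero_of_local` — the GLOBAL input `corank H⁰(K_Σ/K, 𝐃) = 0` follows from
  the local `corank H⁰(K_v, 𝐃) = 0` at any one place (`𝐃^{G_{K,Σ}} ≤ 𝐃^{Γ_{K_v}}`, cotorsion descends to
  submodules); with `isCotorsion_of_linearEquiv` / `isCotorsion_of_injective`.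

Theorems only; no definition, no named fact, no `sorry`. HONEST FRAMING: conditional on the PUBLISHED
named facts consumed as hypotheses; generic bookkeeping; closes nothing by itself
(`--supports stmt-BirchSwinnertonDyer-20727`); no summit statement / BSD is proved by this file.
References: [Greenberg2016Selmer] R. Greenberg, *On the structure of Selmer groups*, PROMS 188 (2016),
§2.2 p. 6 (LEO), §2.3 p. 7 L1–17 ((2), CRK), Prop. 4.1.1 p. 15; [Greenberg2006] Doc. Math. Extra Vol.
Coates (2006), Prop. 3.2 p. 358, Props. 4.1–4.2 pp. 367–368, §5 A p. 373; [Greenberg2010] Kyoto J. Math.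
50 (2010), (4) and (18); [PollackWeston2011] proof of Prop. A.2 (the same corank count).
-/

-- `Summit.BirchSwinnertonDyer.BirchSwinnertonDyer.…`: summit and sub-problem share a name (D-0017 layout).
set_option linter.dupNamespace false
set_option autoImplicit false

noncomputable section

open scoped Classical
open NumberField IsDedekindDomain Field
open Literature.NumberTheory.GaloisRepresentations Literature.NumberTheory.IwasawaTheory
  Literature.NumberTheory.IwasawaTheory.Greenberg2016 Literature.NumberTheory.IwasawaTheory.Greenberg2006
  Summit.BirchSwinnertonDyer.BirchSwinnertonDyer.Theorems.GreenbergFullAtSelmer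
  Summit.BirchSwinnertonDyer.BirchSwinnertonDyer.Theorems.AcTwistDeformation

universe u

namespace Summit.BirchSwinnertonDyer.BirchSwinnertonDyer.Theorems.SignedBaseChangeAcDivGreenbergSqueeze

/-! ## §1 Submodules of cofinitely generated modules -/

section Submodule

variable {Λ : Type u} [CommRing Λ] {M : Type u} [AddCommGroup M] [Module Λ M]

/-- **A submodule of a cofinitely generated `Λ`-module is cofinitely generated**: the Pontryagin dual of
`N ≤ M` is a quotient of that of `M` (`ℚ/ℤ` is injective: `CharacterModule.dual_surjective_of_injective`),
and every balanced dual of `N` is `Λ`-isomorphic to the canonical one.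
[cite: Greenberg2006, Prop. 3.2 (p. 358); §4 p. 367 L33–39] -/
theorem isCofinitelyGenerated_submodule (hM : IsCofinitelyGenerated Λ M) (N : Submodule Λ M) :
    IsCofinitelyGenerated Λ N := by
  intro X _ _ toDual hX
  haveI : Module.Finite Λ (CharacterModule M) := hM _ _ (isDualPairing_characterModule Λ M)
  have hsurj := CharacterModule.dual_surjective_of_injective N.subtype N.injective_subtype
  haveI : Module.Finite Λ (CharacterModule N) :=
    Module.Finite.of_surjective (CharacterModule.dual N.subtype) hsurj
  exact Module.Finite.equiv ((isDualPairing_characterModule Λ N).linearEquiv hX)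

end Submodule

/-! ## §2 `corank Q_{𝓛_η}(K, 𝐃) = m` -/

section QGlobal

variable {Λ : Type u} [CommRing Λ] {K : Type u} [Field K] [NumberField K]
  {S : Set (HeightOneSpectrum (𝓞 K))} [TopologicalSpace Λ] {D : Type u} [AddCommGroup D] [Module Λ D]
  [TopologicalSpace D] [DiscreteTopology D] [ContinuousSMul Λ D]
  {ρ : ContinuousRep (GaloisGroupUnramifiedOutside K S) Λ D}

/-- **`corank Q_{𝓛_η}(K, 𝐃) = m`** for the specification "`⊤` at `η`, `0` elsewhere" when
`corank H¹(K_{η'}, 𝐃) = m` at one other place `η' ∈ S` and `H¹(K_v, 𝐃)` is cotorsion at every other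
place of `Σ` (`Q_{𝓛_η} = ∏_v Q_v`, `Q_η = 0`, `Q_v ≃ H¹(K_v, 𝐃)` elsewhere). The corank-`m` twin of
`AcTwistDeformation.hasCorank_QGlobal_fullAt_one`. [cite: Greenberg2016Selmer, §1 p. 3 L23–25, §2.3 p. 7 L7–17] -/
theorem hasCorank_QGlobal_fullAt_of_corank [IsDomain Λ] (hS : S.Finite) {η η' : HeightOneSpectrum (𝓞 K)}
    (hη' : η' ∈ S) (hne : η' ≠ η) {m : ℕ} (hη'm : HasCorank Λ ((localRep S ρ (Sum.inr η')).H 1) m)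
    (hcot : ∀ v : Place K, InSigma S v → v ≠ Sum.inr η → v ≠ Sum.inr η' →
      IsCotorsion Λ ((localRep S ρ v).H 1)) :
    HasCorank Λ (fullAtSpecification S ρ (Sum.inr η)).QGlobal m := by
  haveI := finite_sigmaPlace (K := K) hS
  haveI : Fintype (SigmaPlace S) := Fintype.ofFinite _
  refine hasCorank_pi_of_isCotorsion (S := fun v : SigmaPlace S ↦ (fullAtSpecification S ρ (Sum.inr η)).Q v.1)
    ⟨Sum.inr η', (inSigma_inr_iff S η').mpr hη'⟩ ?_ ?_
  · have hbot : fullAtSpecification S ρ (Sum.inr η) (Sum.inr η') = ⊥ :=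
      fullAtSpecification_of_ne fun h ↦ hne (Sum.inr_injective h)
    exact hasCorank_of_linearEquiv (Submodule.quotEquivOfEqBot _ hbot).symm hη'm
  · rintro ⟨v, hv⟩ hvη'
    by_cases hvη : v = Sum.inr η
    · subst hvη
      haveI : Subsingleton ((fullAtSpecification S ρ (Sum.inr η)).Q (Sum.inr η)) :=
        Submodule.Quotient.subsingleton_iff.mpr (fullAtSpecification_self (Sum.inr η))
      exact isCotorsion_of_subsingleton
    · have hbot : fullAtSpecification S ρ (Sum.inr η) v = ⊥ := fullAtSpecification_of_ne hvη
      have hne' : v ≠ Sum.inr η' := fun h ↦ hvη' (Subtype.ext h)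
      intro Y _ _ toDual hY
      exact hcot v hv hvη hne' Y _ (isDualPairing_precomp (Submodule.quotEquivOfEqBot _ hbot).symm hY)

/-- **CRK(`𝐃`, `𝓛_η`) from three corank VALUES at corank `m`**: `corank H¹(K_Σ/K, 𝐃) = m`,
`corank S_{𝓛_η} = 0`, `corank H¹(K_{η'}, 𝐃) = m` at one other place `η' ∈ S`, cotorsion elsewhere on `Σ`.
The corank-`m` twin of `GreenbergFullAtSelmer.CRK_fullAt_of_coranks`.
[cite: Greenberg2016Selmer, §2.3 p. 7 L1–17] -/
theorem CRK_fullAt_of_coranks_of_corank [IsDomain Λ] (hS : S.Finite) {η η' : HeightOneSpectrum (𝓞 K)}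
    (hη' : η' ∈ S) (hne : η' ≠ η) {m : ℕ} (hH1 : HasCorank Λ (ρ.H 1) m)
    (hSel : HasCorank Λ (fullAtSpecification S ρ (Sum.inr η)).selmer 0)
    (hη'm : HasCorank Λ ((localRep S ρ (Sum.inr η')).H 1) m)
    (hcot : ∀ v : Place K, InSigma S v → v ≠ Sum.inr η → v ≠ Sum.inr η' →
      IsCotorsion Λ ((localRep S ρ v).H 1)) :
    (fullAtSpecification S ρ (Sum.inr η)).CRK :=
  CRK_of_hasCorank _ (s₀ := 0) (q₀ := m) (by simpa using hH1) hSel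
    (hasCorank_QGlobal_fullAt_of_corank hS hη' hne hη'm hcot)

end QGlobal

/-! ## §3 The squeeze at corank `m`: `h¹ = m` and `h² = 0` -/

section Squeeze

variable {p : ℕ} [Fact p.Prime] {K : Type} [Field K] [NumberField K]
  {S : Set (HeightOneSpectrum (𝓞 K))} {Λ' : Type} [CommRing Λ'] [IsDomain Λ'] [TopologicalSpace Λ']
  [IsTopologicalRing Λ'] {mΛ : ℕ}
  {D : Type} [AddCommGroup D] [Module Λ' D] [TopologicalSpace D] [DiscreteTopology D]
  [ContinuousSMul Λ' D] (ρ : ContinuousRep (GaloisGroupUnramifiedOutside K S) Λ' D)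

/-- **THE CORANK SQUEEZE at corank `m`: `corank H¹(K_Σ/K, 𝐃) = m` and `corank H²(K_Σ/K, 𝐃) = 0`** for
`K` totally imaginary with ONE complex place, `corank 𝐃 = m`, `corank H⁰ = 0`, from Greenberg 2006
Prop. 4.1 (`h⁰ − h¹ + h² = −r₂·m = −m`) and ANY specification `𝓛` with `corank S_𝓛 = 0` and
`corank Q_𝓛 = m` (so `h¹ ≤ 0 + m` by [Greenberg2016Selmer] §2.3 (2), `AcTwistDeformation.corank_le_of_linearMap`):
`m + h² = h¹ ≤ m`. The corank-`m` twin of `AcTwistDeformation.hasCorank_H1_one_and_H2_zero`; no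
vanishing of `H²` above any tower is used. [cite: Greenberg2006, Prop. 4.1 (§4 A, p. 367 L40 – p. 368 L1)]
[cite: Greenberg2016Selmer, §2.3 p. 7 L7–17] [cite: Greenberg2010, (4) and (18)] -/
theorem hasCorank_H1_and_H2_zero_of_corank (h41 : prop41_globalEulerPoincareCorank) (hSf : S.Finite)
    (hS : ∀ v : HeightOneSpectrum (𝓞 K), ((p : ℕ) : 𝓞 K) ∈ v.asIdeal → v ∈ S)
    (hK : ∀ w : InfinitePlace K, w.IsComplex) (hr₂ : InfinitePlace.nrComplexPlaces K = 1)
    (hΛ : Nonempty (Λ' ≃+* MvPowerSeries (Fin mΛ) ℤ_[p]))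
    (hp : ∀ d : D, ∃ n : ℕ, (p ^ n : ℤ) • d = 0) (hcf : IsCofinitelyGenerated Λ' D)
    {m : ℕ} (hm : HasCorank Λ' D m) (h0 : HasCorank Λ' (ρ.H 0) 0)
    (L : Specification S ρ) (hSel : HasCorank Λ' L.selmer 0) (hSelfg : IsCofinitelyGenerated Λ' L.selmer)
    (hQ : HasCorank Λ' L.QGlobal m) (hQfg : IsCofinitelyGenerated Λ' L.QGlobal) :
    HasCorank Λ' (ρ.H 1) m ∧ HasCorank Λ' (ρ.H 2) 0 := by
  have hc1 : HasCorank Λ' (ρ.H 1) (Module.finrank Λ' (CharacterModule (ρ.H 1))) :=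
    hasCorank_characterModule
  have hc2 : HasCorank Λ' (ρ.H 2) (Module.finrank Λ' (CharacterModule (ρ.H 2))) :=
    hasCorank_characterModule
  have key := h41 p K S hSf hS hK Λ' mΛ hΛ D ρ hp hcf m 0 (Module.finrank Λ' (CharacterModule (ρ.H 1)))
    (Module.finrank Λ' (CharacterModule (ρ.H 2))) hm h0 hc1 hc2
  rw [hr₂] at key
  have hle : Module.finrank Λ' (CharacterModule (ρ.H 1)) ≤ 0 + m :=
    corank_le_of_linearMap L.phi hc1 hSel hQ hSelfg hQfg
  have h1 : Module.finrank Λ' (CharacterModule (ρ.H 1)) = m := by push_cast at key; omega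
  have h2 : Module.finrank Λ' (CharacterModule (ρ.H 2)) = 0 := by push_cast at key; omega
  exact ⟨hasCorank_of_isDualPairing (isDualPairing_characterModule Λ' _) h1,
    hasCorank_of_isDualPairing (isDualPairing_characterModule Λ' _) h2⟩

/-! ## §4 LEO and CRK for `𝓛_η` at corank `m`, from the published facts -/

/-- **LEO(`𝐃`) ∧ CRK(`𝐃`, `𝓛_η`) ∧ `corank H¹(K_Σ/K, 𝐃) = m` ∧ `corank H²(K_Σ/K, 𝐃) = 0`, BY THE SQUEEZE,
for a cofinitely generated `p`-primary `𝐃` of ANY corank `m`**, granted the PUBLISHED named facts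
Greenberg 2006 Props. 3.2, 4.1, 4.2 and §5 A (hypotheses by name), for: `K` with every archimedean place
complex and `r₂ = 1`; `S ⊇ {v ∣ p}` finite whose places above `p` are among `η` and `η' ≠ η`, with `η' ∈ S` of
local degree one (`e·f = 1`); LOC_v⁽¹⁾ and `corank H⁰(K_v, 𝐃) = 0` at every finite `v ∈ S`;
`corank H⁰(K_Σ/K, 𝐃) = 0`; and `corank S_{𝓛_η}(K, 𝐃) = 0`. Chain: `corank H²(K_v, 𝐃) = 0` on `S`
(§5 A ⟸ LOC⁽¹⁾); `corank H¹(K_{η'}, 𝐃) = m` (Prop. 4.2 (a) at a degree-one place) and cotorsion of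
`H¹(K_v, 𝐃)` at `v ∤ p` (Prop. 4.2 (b)) and at `∞` (`Γ_ℂ = 1`); §2 `corank Q_{𝓛_η} = m`; cofinite generation
of `S_𝓛 ≤ H¹` and of `Q` (Prop. 3.2, §1); §3 the squeeze; LEO from `corank H² = 0`
(`AcTwistDeformation.leo_of_hasCorank_H2_zero`); CRK from the three values (§2). This discharges the two
ARITHMETIC hypotheses of Greenberg 2016 Prop. 4.1.1 at the crux's instance `𝐃 = Ind_{K̃_∞/K}(E_K[p^∞])`
(`m = 2`, `η = v`, `η' = v̄`) from `corank S_{𝓛_v} = 0` alone (⟸ `stub_torsionSS` by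
`SignedBaseChangeAcDivFiniteExponent.hasCorank_zero_of_xGr₂_isTorsion`).
[cite: Greenberg2016Selmer, §2.2 p. 6, §2.3 p. 7 L1–17, Prop. 4.1.1 p. 15]
[cite: Greenberg2006, Prop. 3.2 p. 358; Props. 4.1, 4.2 (§4 A pp. 367–368); §5 A (p. 373)] -/
theorem leo_and_crk_fullAt_of_squeeze
    (h41 : prop41_globalEulerPoincareCorank) (h42 : prop42_localEulerPoincareCorank)
    (h32 : prop32_cohomology_isCofinitelyGenerated) (h5A : sec5A_localH2_subsingleton_of_LOC1)
    (hSf : S.Finite) (hS : ∀ v : HeightOneSpectrum (𝓞 K), ((p : ℕ) : 𝓞 K) ∈ v.asIdeal → v ∈ S)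
    (hK : ∀ w : InfinitePlace K, w.IsComplex) (hr₂ : InfinitePlace.nrComplexPlaces K = 1)
    (hΛ : Nonempty (Λ' ≃+* MvPowerSeries (Fin mΛ) ℤ_[p]))
    (hp : ∀ d : D, ∃ n : ℕ, (p ^ n : ℤ) • d = 0) (hcf : IsCofinitelyGenerated Λ' D)
    {m : ℕ} (hm : HasCorank Λ' D m) (h0 : HasCorank Λ' (ρ.H 0) 0)
    {η η' : HeightOneSpectrum (𝓞 K)} (hη' : η' ∈ S) (hne : η' ≠ η)
    (hpη' : ((p : ℕ) : 𝓞 K) ∈ η'.asIdeal)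
    (hdeg : η'.asIdeal.ramificationIdx ℤ * η'.asIdeal.inertiaDeg ℤ = 1)
    (hSp : ∀ v : HeightOneSpectrum (𝓞 K), v ∈ S → ((p : ℕ) : 𝓞 K) ∈ v.asIdeal → v = η ∨ v = η')
    (hLOC1 : ∀ v : HeightOneSpectrum (𝓞 K), v ∈ S → LOC1 S ρ (Sum.inr v))
    (h0loc : ∀ v : HeightOneSpectrum (𝓞 K), v ∈ S → HasCorank Λ' ((localRep S ρ (Sum.inr v)).H 0) 0)
    (hSel : HasCorank Λ' (fullAtSpecification S ρ (Sum.inr η)).selmer 0) :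
    LEO S ρ ∧ (fullAtSpecification S ρ (Sum.inr η)).CRK ∧
      HasCorank Λ' (ρ.H 1) m ∧ HasCorank Λ' (ρ.H 2) 0 := by
  -- cofinite generation everywhere (Prop. 3.2)
  have hcfg : ∀ (v : Place K) (i : ℕ), IsCofinitelyGenerated Λ' ((localRep S ρ v).H i) :=
    fun v i ↦ h32.local hSf hS hΛ ρ hp hcf v i
  have hSelfg : IsCofinitelyGenerated Λ' (fullAtSpecification S ρ (Sum.inr η)).selmer :=
    isCofinitelyGenerated_submodule (h32.global hSf hS hΛ ρ hp hcf 1) _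
  -- local coranks: `h²_v = 0` on `S` (§5 A), `h¹_{η'} = m` (Prop. 4.2 (a)), cotorsion elsewhere
  have h2loc : ∀ v : HeightOneSpectrum (𝓞 K), v ∈ S →
      HasCorank Λ' ((localRep S ρ (Sum.inr v)).H 2) 0 := fun v hv ↦
    hasCorank_localH2_zero_of_sec5A ρ h5A hSf hS hΛ hp hcf (hLOC1 v hv)
  have hη'm : HasCorank Λ' ((localRep S ρ (Sum.inr η')).H 1) m :=
    hasCorank_localH1_of_prop42_degree_one ρ h42 hSf hS hΛ hp hcf hpη' hdeg hm (h0loc η' hη')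
      (h2loc η' hη')
  have hcot : ∀ v : Place K, InSigma S v → v ≠ Sum.inr η → v ≠ Sum.inr η' →
      IsCotorsion Λ' ((localRep S ρ v).H 1) := by
    rintro (w | v) hv h1 h2'
    · exact isCotorsion_localH1_inl_of_isComplex S ρ (hK w)
    · have hvS : v ∈ S := (inSigma_inr_iff S v).mp hv
      have hvη : v ≠ η := fun h ↦ h1 (by rw [h])
      have hvη' : v ≠ η' := fun h ↦ h2' (by rw [h])
      have hvp : ((p : ℕ) : 𝓞 K) ∉ v.asIdeal := fun h ↦ by
        rcases hSp v hvS h with h' | h'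
        · exact hvη h'
        · exact hvη' h'
      exact isCotorsion_localH1_of_prop42 ρ h42 hSf hS hΛ hp hcf hvp hm (h0loc v hvS) (h2loc v hvS)
        (hcfg (Sum.inr v) 1)
  -- `Q_{𝓛_η}`: corank `m`, cofinitely generated
  have hQ : HasCorank Λ' (fullAtSpecification S ρ (Sum.inr η)).QGlobal m :=
    hasCorank_QGlobal_fullAt_of_corank hSf hη' hne hη'm hcot
  have hQfg : IsCofinitelyGenerated Λ' (fullAtSpecification S ρ (Sum.inr η)).QGlobal :=
    isCofinitelyGenerated_QGlobal_fullAt hSf η fun v _ ↦ hcfg v 1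
  -- the squeeze
  obtain ⟨hH1, hH2⟩ := hasCorank_H1_and_H2_zero_of_corank ρ h41 hSf hS hK hr₂ hΛ hp hcf hm h0
    (fullAtSpecification S ρ (Sum.inr η)) hSel hSelfg hQ hQfg
  exact ⟨leo_of_hasCorank_H2_zero ρ h32 hSf hS hΛ hp hcf hH2,
    CRK_fullAt_of_coranks_of_corank hSf hη' hne hH1 hSel hη'm hcot, hH1, hH2⟩

end Squeeze

/-! ## §5 Global `corank H⁰ = 0` from a local one (appended, w2 gen 3) -/

section H0Local

variable {Λ : Type u} [CommRing Λ] {M N : Type u} [AddCommGroup M] [Module Λ M] [AddCommGroup N]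
  [Module Λ N]

/-- Cotorsion is invariant under `Λ`-linear isomorphism (duals precompose, `isDualPairing_precomp`).
[cite: Greenberg2016Selmer, §1 p. 1 L30–32] -/
theorem isCotorsion_of_linearEquiv (e : M ≃ₗ[Λ] N) (h : IsCotorsion Λ N) : IsCotorsion Λ M :=
  fun X _ _ _ hX ↦ h X _ (isDualPairing_precomp e.symm hX)

/-- A module mapping `Λ`-linearly and INJECTIVELY into a cotorsion module is cotorsion.
[cite: Greenberg2016Selmer, §1 p. 1 L30–32] -/
theorem isCotorsion_of_injective (f : M →ₗ[Λ] N) (hf : Function.Injective f) (h : IsCotorsion Λ N) :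
    IsCotorsion Λ M :=
  isCotorsion_of_linearEquiv (LinearEquiv.ofInjective f hf) (isCotorsion_submodule h _)

/-- Cotorsion ⇒ corank `0` over a domain. [cite: Greenberg2016Selmer, §2.3 p. 7 L5–13] -/
theorem hasCorank_zero_of_isCotorsion' [IsDomain Λ] (h : IsCotorsion Λ M) : HasCorank Λ M 0 :=
  fun X _ _ toDual hX ↦ Module.finrank_eq_zero_of_rank_eq_zero
    (rank_eq_zero_iff.mpr fun x ↦ by
      obtain ⟨⟨a, ha⟩, hax⟩ := @h X _ _ toDual hX x
      exact ⟨a, nonZeroDivisors.ne_zero ha, hax⟩)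

variable {p : ℕ} [Fact p.Prime] {K : Type} [Field K] [NumberField K]
  {S : Set (HeightOneSpectrum (𝓞 K))} {Λ' : Type} [CommRing Λ'] [IsDomain Λ'] [TopologicalSpace Λ']
  [IsTopologicalRing Λ']
  {D : Type} [AddCommGroup D] [Module Λ' D] [TopologicalSpace D] [DiscreteTopology D]
  [IsTopologicalAddGroup D] [ContinuousSMul Λ' D] (ρ : ContinuousRep (GaloisGroupUnramifiedOutside K S) Λ' D)

omit [IsTopologicalRing Λ'] [DiscreteTopology D] in
/-- **`corank H⁰(K_Σ/K, 𝐃) = 0` from `corank H⁰(K_v, 𝐃) = 0` at ONE place `v`**: `H⁰ = 𝐃^G`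
(`ContinuousCohomology.zeroIso`) and `𝐃^{G_{K,Σ}} ≤ 𝐃^{Γ_{K_v}}` (`Γ_{K_v}` acts through `G_{K,Σ}`), a
`Λ`-submodule of a cotorsion module (cofinite generation + corank `0` locally). So the global `h⁰ = 0` input
of Greenberg 2006 Prop. 4.1 follows from the local one at any `v ∈ Σ` — one hypothesis fewer for the
corank-two instance of Prop. 4.1.1. [cite: Greenberg2006, Props. 4.1, 4.2 (§4 A pp. 367–368: the terms corank H⁰)]
[cite: Greenberg2016Selmer, §1 p. 3 L19–28] -/
theorem hasCorank_H0_zero_of_local (v : Place K)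
    (hcfg : IsCofinitelyGenerated Λ' ((localRep S ρ v).H 0))
    (h0loc : HasCorank Λ' ((localRep S ρ v).H 0) 0) : HasCorank Λ' (ρ.H 0) 0 := by
  -- `H⁰` as invariants, globally and locally
  let eG : ρ.H 0 ≃ₗ[Λ'] ρ.toTopRep.ρ.invariants :=
    (ContinuousCohomology.zeroIso ρ.toTopRep).toContinuousLinearEquiv.toLinearEquiv
  let eL : (localRep S ρ v).H 0 ≃ₗ[Λ'] (localRep S ρ v).toTopRep.ρ.invariants :=
    (ContinuousCohomology.zeroIso (localRep S ρ v).toTopRep).toContinuousLinearEquiv.toLinearEquiv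
  -- global invariants inject into local invariants
  let ι : ρ.toTopRep.ρ.invariants →ₗ[Λ'] (localRep S ρ v).toTopRep.ρ.invariants :=
    { toFun := fun d ↦ ⟨(d : D), fun σ ↦ d.2 (localToUnramified S v σ)⟩
      map_add' := fun _ _ ↦ rfl
      map_smul' := fun _ _ ↦ rfl }
  have hι : Function.Injective ι := fun x y h ↦ by
    apply Subtype.ext
    have h' := congrArg Subtype.val h
    exact h'
  -- the local `H⁰` is cotorsion, hence so are the local invariants, the global invariants, `H⁰`
  have hL : IsCotorsion Λ' ((localRep S ρ v).H 0) :=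
    isCotorsion_of_isCofinitelyGenerated_of_hasCorank_zero hcfg h0loc
  have hLi : IsCotorsion Λ' (localRep S ρ v).toTopRep.ρ.invariants := isCotorsion_of_linearEquiv eL.symm hL
  have hGi : IsCotorsion Λ' ρ.toTopRep.ρ.invariants := isCotorsion_of_injective ι hι hLi
  exact hasCorank_zero_of_isCotorsion' (isCotorsion_of_linearEquiv eG hGi)

end H0Local

end Summit.BirchSwinnertonDyer.BirchSwinnertonDyer.Theorems.SignedBaseChangeAcDivGreenbergSqueeze

end
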